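import Mathlib
import HarnessLib
import Summits.ResolutionOfSingularities.ResolutionOfSingularities.Theorems.WildQuotientsWildQuotientResolutionS1aGoodOfKilledNode
import Summits.ResolutionOfSingularities.ResolutionOfSingularities.Theorems.WildQuotientsWildQuotientResolutionS1aJInf

/-!
# W4.5c SIG NP v3.1 — the np-CLEAN frame: INTRINSIC non-principal locus + CLEAN GLUED killability (RULINGS R-F12/R-F13, plan-1 g14, the
latter adopting lead-1's F11 «glued killability»; supersedes the
readings of SIG NP v1 (np-∃ with plain killability) and SIG NP v2 (np-ATLAS), both kept in the crux dir as records)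

[OURS · L1 W4.5c · plan-1 g14 SIG file — DEFINITIONS + statement Props only, no proofs; counted 0; AI-level < expert review]
Crux stmt-ResolutionOfSingularities-17941, line `s1a-logminvertex`. Memo: `Lines/s1a-logminvertex-NP-FRAME-v1-1.md`.

THE DESIGN. The measure's locus is the INTRINSIC `npLocus M` (no principal node data at the point — SIG NP v1; multiplicative-type fixed
points are np-good through the Laurent node of SIG (M), graded by `Π j, ZMod (r j)` with one `r j = 0`). Killability is CLEAN GLUED killability (R-F13 = lead-1 F11 + cleanliness):
`CleanGluedKillableAt M v` asks for a LOCAL PRINCIPAL CENTRE around `v` — a `G`-stable open `U`, a Rees filtration on `U` which is a principal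
centre for the restricted action (every point of `U` has a principal-centre or idle chart), with support CLOSED IN `V`, containing `v`, and
contained in `npLocus M` (clean). `ExtendRees.exists_isPrincipalCentre_of_local` extends it by the unit filtration to a GLOBAL principal centre
with the same support, so the K move needs NO chart agreement / K-U / node refinement (lead-1 F11) and NO tightness statement; cleanliness +
NP5 make the support a clopen cluster of components of `npLocus`, which is what makes killability of the OTHER components transport-stable
under the move (shrink their witnesses away from the support). `CleanKillableAt` (chart level) is kept as the auxiliary notion producers deliver. With this, the K-side cover
argument is PURE BOOKKEEPING: on a clean kill chart `npLocus ∩ O = supp(𝒦_d) ∩ O` (⊇ by cleanliness; ⊆ = NP5, the off-centre half of (Z1):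
off the centre the chart's own node data is principal, by transport from the killed blow-up), so the np-components through cleanly killable
points are locally irreducible and pairwise disjoint, and at `npJInf M = ⊥` every component is covered by clean kill charts whose formal centres
glue (K-U, RESTRICT) to a global principal centre with support exactly the component. NO atlas data, NO compatibility, NO ADD-BAD / ADD-NP /
type-constancy statement is used on the K side; every such question (dirty-killable points, mixed additive/multiplicative formal components)
is absorbed by the A side's PROGRESS claim, where non-cleanly-killable points count as non-killable. `GModel` is UNCHANGED.
-/

set_option linter.dupNamespace false

noncomputable section

namespace Summit.ResolutionOfSingularities.ResolutionOfSingularities.Theorems.WildQuotientResolution.S1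

open CategoryTheory AlgebraicGeometry TopologicalSpace
open Literature.AlgebraicGeometry.Resolution
open Summit.ResolutionOfSingularities.ResolutionOfSingularities.Theorems.WildQuotientResolution.S1.ProducerStep
open Summit.ResolutionOfSingularities.ResolutionOfSingularities.Theorems.WildQuotientResolution.S1.NodeAtlas
open Literature.AlgebraicGeometry.RelativeSpec

namespace GameFrame.GModel

variable {p : ℕ} {X' X₁ : Scheme.{0}} {q : X' ⟶ X₁} {G : Type} [Group G] {ρ : G →* Aut X'} {g₀ : G}

/-- **Principal node chart** (np-∃ reading): the stable affine open `O` carries node data `(B, 𝒜, σ, e)` exactly as in `IsNodeChart` /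
`isGoodAt_of_killedNode` — a tame node at `p` graded by `Π j, ZMod (r j)`, `e : Γ(V, O) ≃ 𝒜 0` intertwining `g₀` with `σ`, of finite
type over a Noetherian ring of `σ`-fixed degree-`0` elements — whose augmentation ideal is PRINCIPAL. [OURS · L1 W4.5c · SIG NP v1/v3] -/
def IsPrincipalNodeChart (M : GModel p q G ρ g₀) (O : M.act.StableAffineOpens) : Prop :=
  IsAffineOpen O.1 ∧
  ∃ (m : ℕ) (r : Fin m → ℕ) (B : Type) (_ : CommRing B) (𝒜 : (Π j : Fin m, ZMod (r j)) → AddSubgroup B)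
    (_ : GradedRing 𝒜) (σ : B ≃+* B) (e : Γ(M.V, O.1) ≃+* ↥(𝒜 0)),
    IsTameNode p B 𝒜 σ ∧
    (∀ t : Γ(M.V, O.1),
      ((e ((M.act.aut g₀⁻¹).hom.appLE O.1 O.1 (O.2.1 g₀⁻¹).ge t) : ↥(𝒜 0)) : B) = σ ((e t : ↥(𝒜 0)) : B)) ∧
    (augmentationIdeal σ).IsPrincipal ∧
    ∃ (R₀ : Type) (_ : CommRing R₀) (_ : IsNoetherianRing R₀) (_ : Algebra R₀ B),
      Algebra.FiniteType R₀ B ∧ (∀ a : R₀, σ (algebraMap R₀ B a) = algebraMap R₀ B a) ∧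
      (∀ a : R₀, algebraMap R₀ B a ∈ 𝒜 0)

/-- **The non-principal locus** `npLocus M`: points with NO principal node chart. It is closed (complement = union of opens) and
`G`-stable, contains `M.badLocus` (`isGoodAt_of_killedNode`), excludes every multiplicative-type fixed point (Laurent node, SIG (M)),
and is the bad locus of the census engine's FRAME semantics. [OURS · L1 W4.5c · SIG NP v1/v3] -/
def npLocus (M : GModel p q G ρ g₀) : Set M.V :=
  {u | ¬ ∃ O : M.act.StableAffineOpens, u ∈ O.1 ∧ M.IsPrincipalNodeChart O}

/-- **np-terminal**: every point has a principal node chart. -/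
def NpTerminal (M : GModel p q G ρ g₀) : Prop := M.npLocus = ∅

/-- **Clean killability**: a principal-centre chart through `v` (`0 < d`, as in `KillableAt`) whose centre support inside the chart lies
in the np locus — the kill deletes np-bad points only. [OURS · L1 W4.5c · SIG NP v3] -/
def CleanKillableAt (M : GModel p q G ρ g₀) (v : M.V) : Prop :=
  ∃ (𝒦 : ReesFiltration M.V) (d : ℕ) (O : M.act.StableAffineOpens), 0 < d ∧ v ∈ O.1 ∧
    IsPrincipalCentreChart p M.act g₀ 𝒦 d O ∧ ((𝒦.ideal d).support : Set M.V) ∩ (O.1 : Set M.V) ⊆ M.npLocus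

/-- **Clean glued killability** (R-F13 = lead-1 F11 + cleanliness + `v ∈ supp`): `v` lies on the support of a LOCAL PRINCIPAL CENTRE with
closed, clean support — the tree's local notion of `ExtendRees.exists_isPrincipalCentre_of_local`. [OURS · L1 W4.5c · SIG NP v3.1] -/
def CleanGluedKillableAt (M : GModel p q G ρ g₀) (v : M.V) : Prop :=
  ∃ (U : M.V.Opens) (hU : ∀ g : G, (M.act.aut g).hom ⁻¹ᵁ U = U) (𝒦 : ReesFiltration (U : Scheme.{0})) (d : ℕ),
    0 < d ∧ IsPrincipalCentre p (M.act.restrict U hU) g₀ 𝒦 d ∧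
    IsClosed (U.ι.base '' ((𝒦.ideal d).support : Set (U : Scheme.{0}))) ∧
    v ∈ U.ι.base '' ((𝒦.ideal d).support : Set (U : Scheme.{0})) ∧
    U.ι.base '' ((𝒦.ideal d).support : Set (U : Scheme.{0})) ⊆ M.npLocus

/-- The np-NON-KILLABLE locus of the np-CLEAN frame: np-bad points with no CLEAN GLUED local kill (verbatim `nonKillable` with `npLocus` /
`CleanGluedKillableAt`). [SIG NP v3.1] -/
def npNonKillable (M : GModel p q G ρ g₀) : Set M.V :=
  M.npLocus ∩ {v | ¬ M.CleanGluedKillableAt v}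

/-- `jInf` of the np-CLEAN frame. [SIG NP v3] -/
def npJInf (M : GModel p q G ρ g₀) : WithBot ℕ∞ :=
  topologicalKrullDim ↥(npNonKillable M)

end GameFrame.GModel

/-! ## The statements the np-frame port must supply (kernel unless marked RESEARCH) -/

/-- (NP1, kernel — from `isGoodAt_of_killedNode`) typed-bad points are np-bad. [SIG NP v1/v3] -/
def NpContainsBad (p : ℕ) : Prop :=
  ∀ ⦃X' X₁ : Scheme.{0}⦄ (q : X' ⟶ X₁) (G : Type) [Group G] [Finite G] (ρ : G →* Aut X') (g₀ : G),
    p.Prime → (∀ g : G, g ∈ Subgroup.zpowers g₀) →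
    ∀ M : GameFrame.GModel p q G ρ g₀, M.badLocus ⊆ M.npLocus

/-- (NP2, kernel) np-terminal ⇒ terminal (hence the existing end assembly `globalKillTame_of_winningStrategy` applies unchanged after it).
[SIG NP v1/v3] -/
def NpTerminalTerminal (p : ℕ) : Prop :=
  ∀ ⦃X' X₁ : Scheme.{0}⦄ (q : X' ⟶ X₁) (G : Type) [Group G] [Finite G] (ρ : G →* Aut X') (g₀ : G),
    p.Prime → (∀ g : G, g ∈ Subgroup.zpowers g₀) →
    ∀ M : GameFrame.GModel p q G ρ g₀, M.NpTerminal → M.Terminal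

/-- (NP3, kernel) `npLocus` is closed and `G`-stable. [SIG NP v1/v3] -/
def NpClosedStable (p : ℕ) : Prop :=
  ∀ ⦃X' X₁ : Scheme.{0}⦄ (q : X' ⟶ X₁) (G : Type) [Group G] [Finite G] (ρ : G →* Aut X') (g₀ : G),
    ∀ M : GameFrame.GModel p q G ρ g₀,
      IsClosed M.npLocus ∧ ∀ (g : G) (u : M.V), (M.act.aut g).hom.base u ∈ M.npLocus ↔ u ∈ M.npLocus

/-- (NP4a, kernel — KILLED OVER THE CENTRE) after a move along a principal centre, NO np-bad point of the new model lies over the part of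
the support inside a principal-centre chart: the producer-step charts there are KILLED tame nodes, i.e. principal node data (the input of
`isGoodAt_of_killedNode`, read one step earlier). [SIG NP v3] -/
def NpKilledOverCentre (p : ℕ) : Prop :=
  ∀ ⦃X' X₁ : Scheme.{0}⦄ (q : X' ⟶ X₁) (G : Type) [Group G] [Finite G] (ρ : G →* Aut X') (g₀ : G),
    p.Prime → (∀ g : G, g ∈ Subgroup.zpowers g₀) →
    ∀ (M M' : GameFrame.GModel p q G ρ g₀) (𝒦 : ReesFiltration M.V) (d : ℕ) (O : M.act.StableAffineOpens),
      M.HasNoetherianBase → 0 < d → IsPrincipalCentreChart p M.act g₀ 𝒦 d O →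
      ∀ π' : M'.V ⟶ M.V, IsBlowup π' (𝒦.ideal d) → M'.π = π' ≫ M.π →
        (∀ g : G, (M'.act.aut g).hom ≫ π' = π' ≫ (M.act.aut g).hom) →
        ∀ u' : M'.V, π'.base u' ∈ (O.1 : Set M.V) → π'.base u' ∈ ((𝒦.ideal d).support : Set M.V) → u' ∉ M'.npLocus

/-- (NP4b, kernel — TRANSPORT OFF THE SUPPORT) off the support the blow-up is an isomorphism and np-badness is transported both ways
(node data pull back and push forward along a `G`-isomorphism of stable affine opens). [SIG NP v3] -/
def NpTransportOffSupport (p : ℕ) : Prop :=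
  ∀ ⦃X' X₁ : Scheme.{0}⦄ (q : X' ⟶ X₁) (G : Type) [Group G] [Finite G] (ρ : G →* Aut X') (g₀ : G),
    p.Prime → (∀ g : G, g ∈ Subgroup.zpowers g₀) →
    ∀ (M M' : GameFrame.GModel p q G ρ g₀) (𝒦 : ReesFiltration M.V) (d : ℕ),
      M.HasNoetherianBase → M.IsMoveOf M' 𝒦 d →
      ∀ π' : M'.V ⟶ M.V, IsBlowup π' (𝒦.ideal d) → M'.π = π' ≫ M.π →
        (∀ g : G, (M'.act.aut g).hom ≫ π' = π' ≫ (M.act.aut g).hom) →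
        ∀ u' : M'.V, π'.base u' ∉ ((𝒦.ideal d).support : Set M.V) → (u' ∈ M'.npLocus ↔ π'.base u' ∈ M.npLocus)

/-- (NP5, kernel — the off-centre half of (Z1) for `npLocus`; lead-1's estimate item (b)) on a principal-centre chart the np-bad points lie
on the centre: off the centre the chart's own node data, localised, is principal (transport from the killed blow-up, which is an isomorphism
there). Together with cleanliness: `npLocus ∩ O = supp(𝒦_d) ∩ O` on a CLEAN kill chart. [SIG NP v3] -/
def NpOnCentre (p : ℕ) : Prop :=
  ∀ ⦃X' X₁ : Scheme.{0}⦄ (q : X' ⟶ X₁) (G : Type) [Group G] [Finite G] (ρ : G →* Aut X') (g₀ : G),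
    p.Prime → (∀ g : G, g ∈ Subgroup.zpowers g₀) →
    ∀ (M : GameFrame.GModel p q G ρ g₀) (𝒦 : ReesFiltration M.V) (d : ℕ) (O : M.act.StableAffineOpens),
      0 < d → IsPrincipalCentreChart p M.act g₀ 𝒦 d O →
      M.npLocus ∩ (O.1 : Set M.V) ⊆ ((𝒦.ideal d).support : Set M.V)

/-- (NP6, kernel — K_np = KILL-TOUCH, lead-1 F11) a clean glued kill around an np-bad point gives a GLOBAL principal centre (`0 < d`) whose
support is that closed clean set (hence a non-empty clopen cluster of components of `npLocus`, by NP5): `ExtendRees.exists_isPrincipalCentre_of_local`.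
The measure bookkeeping (components of `npLocus` drop, `npNonKillable` transported isomorphically by NP4a/NP4b + witness shrinking) is the port's. -/
def NpKillTouch (p : ℕ) : Prop :=
  ∀ ⦃X' X₁ : Scheme.{0}⦄ (q : X' ⟶ X₁) (G : Type) [Group G] [Finite G] (ρ : G →* Aut X') (g₀ : G),
    p.Prime → (∀ g : G, g ∈ Subgroup.zpowers g₀) →
    ∀ (M : GameFrame.GModel p q G ρ g₀) (v : M.V), v ∈ M.npLocus → M.CleanGluedKillableAt v →
      ∃ (𝒦' : ReesFiltration M.V) (d : ℕ), 0 < d ∧ IsPrincipalCentre p M.act g₀ 𝒦' d ∧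
        v ∈ ((𝒦'.ideal d).support : Set M.V) ∧ IsClosed ((𝒦'.ideal d).support : Set M.V) ∧
        ((𝒦'.ideal d).support : Set M.V) ⊆ M.npLocus

/- (ADD-NP — NOT USED in the np-CLEAN frame; recorded for the A side only: it was the residue of K-TIGHT in the np-∃ reading with PLAIN
killability). On a principal-centre chart `O` of a model whose node ring data `(B, 𝒜, σ)` has formal centre `V(f)`: every point of the
zero locus of the degree-`0` trace of the centre that is np-GOOD is so through the chart's OWN Laurent refinement, i.e. is of
multiplicative type. Recorded here only by its informal shape; the successor types it if the np-∃ reading is adopted. (No declaration.) -/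

end Summit.ResolutionOfSingularities.ResolutionOfSingularities.Theorems.WildQuotientResolution.S1

end
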